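import Mathlib
import Summits.ValiantsHypothesis.ValiantsHypothesis.Theorems.GrenetZeonPolySizeQPAlgebraSquareZeroPoints
import HarnessLib

/-!
# Crux `GrenetZeon.PolySizeQPAlgebra` (stmt-ValiantsHypothesis-8064), line `vbp-slice-dealg` —
# the type-independent local Hessian bound for SQUARE-ZERO coefficient algebras (`n ≥ 5`)

Input (B) of the `c = 1` box (`…LocalReduction`: `LocalHessianBound n`) asks, for a local piece
`(R, φ, λ, A, F = λ(det A))` and a point `p` with `det A(p) = 0` in `R`, for `rank Hess F(p) ≤ 2·dim R·n`.
The tree has it at residual corank `≤ 2` for every `R` (`…ResidualCorankTwo`) and, at normal forms, for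
square-zero residual blocks (`…SquareZeroIdeal`, `…SquareZeroPoints`).  This file supplies the choice of
a residually maximal minor at an arbitrary point and assembles:

* `exists_maximal_residual_minor` — for a square matrix `B` over `R` and a ring map `φ` to a field there
  is a `k × k` minor with `φ(det) ≠ 0` all of whose one-row-one-column borderings are killed by `φ`
  (finite maximisation; `k = 0` qualifies).
* `exists_residual_minor_pred`, `exists_residual_minor_sub` — cofactor descent: a residually
  non-vanishing `(j+d)`-minor contains a residually non-vanishing `j`-minor (Laplace along a row).
* `rank_hess0_transl_le_of_sqZero_algebra` — **for every finite-dimensional commutative `ℂ`-algebra `R`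
  with a character `φ` of SQUARE-ZERO kernel (`ℂ[x]/x²`, `ℂ[x,y]/(x,y)²`, …, every `ℂ ⊕ V` with `V² = 0`),
  every functional `λ`, every affine `n × n` matrix `A` over `R` with `n ≥ 5`, and every point `p` with
  `det A(p) = 0` in `R`: `rank Hess λ(det A)(p) ≤ 2 · dim_ℂ R · n`.**  (Residual corank `≤ 2`:
  `…ResidualCorankTwo`; `= 3`: `rank_hess0_transl_le_of_sqZero_point_three`, using `n ≥ 5`; `≥ 4`:
  the Hessian vanishes.)

So `LocalHessianBound n` (hence, with good `(s+1)`-spaces, every point `(n, s)` of the `c = 1` box whose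
pieces are square-zero) holds for all square-zero local types and `n ≥ 5`; the only square-zero residue is
residual corank `3` at `n ≤ 4`.  Non-square-zero types of residual corank `≥ 3` remain (`AL(q)`/G).
HONEST FRAMING: a rank theorem for a class of coefficient algebras; no stub of the line is closed; VP ≠ VNP
is not moved.

References: T. Mignon, N. Ressayre, IMRN 2004:79, §2 [MignonRessayre2004].
-/

noncomputable section

open MvPolynomial Matrix
open Literature.Computability.AlgebraicComplexity

-- single-conjunct layout `Summits/ValiantsHypothesis/ValiantsHypothesis`: duplicated namespace by design
set_option linter.dupNamespace false

namespace Summit.ValiantsHypothesis.ValiantsHypothesis.Theorems.GrenetZeonPolySizeQPAlgebra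

section MaxMinor

variable {ι : Type*} [Fintype ι] {R K : Type*} [CommRing R] [Field K]

/-- **A residually maximal minor exists.**  For a square matrix `B` over `R` and a ring map `φ : R → K`
to a field there is a size `k` and a `k × k` minor (rows `r`, columns `c`) with `φ(det) ≠ 0` such that
every minor bordering it by one row and one column is killed by `φ` (take `k` maximal with a residually
non-vanishing `k`-minor; `k = 0` qualifies). [folklore] -/
theorem exists_maximal_residual_minor (φ : R →+* K) (B : Matrix ι ι R) :
    ∃ (k : ℕ) (r c : Fin k → ι), φ (B.submatrix r c).det ≠ 0 ∧
      ∀ a b : ι, φ (B.submatrix (Sum.elim r fun _ : Unit => a) (Sum.elim c fun _ : Unit => b)).det = 0 := by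
  classical
  -- sizes admitting a residually non-vanishing minor
  set T : Finset ℕ := (Finset.range (Fintype.card ι + 2)).filter
    fun k => ∃ r c : Fin k → ι, φ (B.submatrix r c).det ≠ 0 with hT
  have h0 : 0 ∈ T := by
    rw [hT, Finset.mem_filter]
    refine ⟨Finset.mem_range.2 (by omega), Fin.elim0, Fin.elim0, ?_⟩
    rw [Matrix.det_isEmpty, map_one]
    exact one_ne_zero
  obtain ⟨k, hkT, hkmax⟩ := T.exists_max_image id ⟨0, h0⟩
  rw [hT, Finset.mem_filter] at hkT
  obtain ⟨hk, r, c, hrc⟩ := hkT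
  refine ⟨k, r, c, hrc, fun a b => ?_⟩
  by_contra hne
  -- the bordered minor, reindexed by `Fin (k+1)`, is a residually non-vanishing `(k+1)`-minor
  set e : Fin k ⊕ Unit ≃ Fin (k + 1) := (Equiv.sumCongr (Equiv.refl _) finOneEquiv.symm).trans finSumFinEquiv
    with he
  have hdet : φ (B.submatrix ((Sum.elim r fun _ : Unit => a) ∘ e.symm)
      ((Sum.elim c fun _ : Unit => b) ∘ e.symm)).det ≠ 0 := by
    rwa [← Matrix.submatrix_submatrix, Matrix.det_submatrix_equiv_self]
  -- `k + 1` rows cannot be injective beyond `|ι|`, and otherwise contradict maximality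
  have hk1 : k + 1 ∈ T := by
    rw [hT, Finset.mem_filter]
    refine ⟨Finset.mem_range.2 ?_, _, _, hdet⟩
    by_contra hlt
    have hcard : Fintype.card ι < Fintype.card (Fin (k + 1)) := by rw [Fintype.card_fin]; omega
    obtain ⟨i, j, hij, hne'⟩ := Fintype.exists_ne_map_eq_of_card_lt
      ((Sum.elim r fun _ : Unit => a) ∘ e.symm) hcard
    exact hdet (by rw [Matrix.det_zero_of_row_eq hij (funext fun l => by
      simp only [Matrix.submatrix_apply, hne']), map_zero])
  have := hkmax (k + 1) hk1
  simp at this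

omit [Fintype ι] in
/-- **Cofactor descent.**  A residually non-vanishing `(j+1)`-minor contains a residually non-vanishing
`j`-minor (Laplace expansion along the first row). [folklore] -/
theorem exists_residual_minor_pred (φ : R →+* K) (B : Matrix ι ι R) {j : ℕ} (r c : Fin (j + 1) → ι)
    (h : φ (B.submatrix r c).det ≠ 0) :
    ∃ r' c' : Fin j → ι, φ (B.submatrix r' c').det ≠ 0 := by
  by_contra hall
  push Not at hall
  apply h
  rw [Matrix.det_succ_row_zero, map_sum]
  refine Finset.sum_eq_zero fun b _ => ?_
  rw [map_mul, map_mul, Matrix.submatrix_submatrix, hall, mul_zero]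

omit [Fintype ι] in
/-- Cofactor descent, iterated: a residually non-vanishing `(j+d)`-minor contains a residually
non-vanishing `j`-minor. [folklore] -/
theorem exists_residual_minor_sub (φ : R →+* K) (B : Matrix ι ι R) (j d : ℕ) :
    ∀ r c : Fin (j + d) → ι, φ (B.submatrix r c).det ≠ 0 →
      ∃ r' c' : Fin j → ι, φ (B.submatrix r' c').det ≠ 0 := by
  induction d with
  | zero => exact fun r c h => ⟨r, c, h⟩
  | succ d ih =>
    intro r c h
    obtain ⟨r₁, c₁, h₁⟩ := exists_residual_minor_pred φ B (j := j + d) r c h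
    exact ih r₁ c₁ h₁

end MaxMinor

/-! ### The local Hessian bound for square-zero coefficient algebras, `n ≥ 5` -/

section SqZeroBound

variable {R : Type*} [CommRing R] [Algebra ℂ R] [Module.Finite ℂ R] {σ : Type*} [Fintype σ] [DecidableEq σ]

/-- **`LocalHessianBound` for square-zero coefficient algebras (`n ≥ 5`).**  Let `R` be a
finite-dimensional commutative `ℂ`-algebra with a character `φ` whose kernel is square-zero
(`φ a = φ b = 0 ⟹ ab = 0`), `λ : R → ℂ` ANY linear functional, `A` an `n × n` matrix of affine forms
over `R` with read-out `F = λ(det A)`, `n ≥ 5`, and `p` a point with `det A(p) = 0` in `R`.  Then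
`rank Hess F(p) ≤ 2 · dim_ℂ R · n`.  Proof: take a residually maximal minor of `A(p)`
(`exists_maximal_residual_minor`) of size `k`; if `k ≥ n - 2`, descend to a unit `(n-2)`-minor
(`exists_residual_minor_sub`) and use `…ResidualCorankTwo`; if the residual corank is `3` use
`rank_hess0_transl_le_of_sqZero_point_three` (`k = n - 3 ≥ 2`); if it is `≥ 4` the Hessian vanishes
(`hess0_transl_rank_eq_zero_of_sqZero_point`). [cite: MignonRessayre2004, §2] -/
theorem rank_hess0_transl_le_of_sqZero_algebra {n : ℕ} (hn : 5 ≤ n) (φ : R →ₐ[ℂ] ℂ)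
    (hsq : ∀ a b : R, φ a = 0 → φ b = 0 → a * b = 0) (l : R →ₗ[ℂ] ℂ)
    (A : Matrix (Fin n) (Fin n) (MvPolynomial σ R)) (F : MvPolynomial σ ℂ)
    (hA : ∀ a b, (A a b).totalDegree ≤ 1) (hF : ∀ d, l (coeff d A.det) = coeff d F) (p : σ → ℂ)
    (hp : eval (fun i => algebraMap ℂ R (p i)) A.det = 0) :
    (hess0 (transl p F)).rank ≤ 2 * Module.finrank ℂ R * n := by
  classical
  haveI : Nontrivial R := RingHom.domain_nontrivial (φ : R →+* ℂ)
  set B : Matrix (Fin n) (Fin n) R := A.map (eval fun i => algebraMap ℂ R (p i)) with hB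
  obtain ⟨k, r, c, hu, hmax⟩ := exists_maximal_residual_minor (φ : R →+* ℂ) B
  -- `k ≤ n`: the rows of a residually non-vanishing minor are injective
  have hr : Function.Injective r := by
    intro i j hij
    by_contra hne
    apply hu
    rw [Matrix.det_zero_of_row_eq hne (funext fun l => by simp only [Matrix.submatrix_apply, hij]),
      map_zero]
  have hkn : k ≤ n := by simpa using Fintype.card_le_of_injective r hr
  by_cases hk2 : n ≤ k + 2
  · -- residual corank `≤ 2`
    obtain ⟨d, hd⟩ : ∃ d, k = (n - 2) + d := ⟨k - (n - 2), by omega⟩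
    subst hd
    obtain ⟨r', c', h'⟩ := exists_residual_minor_sub (φ : R →+* ℂ) B (n - 2) d r c hu
    have h := rank_hess0_transl_le_of_residual_minor_ne_zero φ (ker_pow_two_eq_bot_of_sqZero φ hsq)
      l A F hA hF p hp r' c' h' (by simp only [Fintype.card_fin]; omega)
    simpa only [Fintype.card_fin] using h
  · -- residual corank `q = n - k ≥ 3`
    obtain ⟨q, hq⟩ : ∃ q, n = k + q := ⟨n - k, by omega⟩
    rcases Nat.lt_or_ge q 4 with hq4 | hq4
    · have hq3 : q = 3 := by omega
      subst hq3
      have h := rank_hess0_transl_le_of_sqZero_point_three (m := Fin 3) φ hsq l A F hA hF p r c hu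
        hmax (by simp only [Fintype.card_fin]; omega) (Fintype.card_fin 3)
        (by simp only [Fintype.card_fin]; omega)
      simpa only [Fintype.card_fin] using h
    · have h := hess0_transl_rank_eq_zero_of_sqZero_point (m := Fin q) φ hsq l A F hA hF p r c hu
        hmax (by simp only [Fintype.card_fin]; omega) (by simpa only [Fintype.card_fin] using hq4)
      rw [h]
      exact Nat.zero_le _

end SqZeroBound

end Summit.ValiantsHypothesis.ValiantsHypothesis.Theorems.GrenetZeonPolySizeQPAlgebra

end
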